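import Summits.CriticalPhenomena.PercolationContinuityZ3.Theorems.PercNearOneGluingNoHeavyLowerTailCovTriangleOfR2
import Literature.Probability.Percolation.TwoSetExchange
import Literature.Probability.Percolation.PercolationEvents
import Literature.Probability.LatticeModels.ProdBernoulliIndependence
import HarnessLib

/-!
# `NoHeavyLowerTail` (stmt-CriticalPhenomena-4575) — the TYPED covariance triangle CT(S,T,A,B) follows from R2(S,T,A,B) on every finite weighted graph

Support file (prover prim-facecert gen 10; `--supports stmt-CriticalPhenomena-4575`).  No definitions, no named facts, no sorries.

prim-ineq-prove-3's typed family: vertex SETS `S, T`, `D = {S ↮ T}`, `U = Dᶜ = {S ~ T}`, `A` an increasing event of type (+) for `(C_S, C_T)`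
(closed under enlarging `C_S` and shrinking `C_T`, e.g. `{X ~ Y}` with `X ⊆ S`), `B` increasing of type (−) (e.g. `{X' ~ Y'}` with `X' ⊆ T`).  Then the
two-set row `μ(D)μ(D∩A∩B) ≤ μ(D∩A)μ(D∩B)` is van den Berg–Häggström–Kahn's `setTwoClusterExchange`, the two Harris rows hold (`U` is increasing), and
`CovTrianglePath.covTriangle_of_r2` gives:  **CT(S,T,A,B) ⟸ R2(S,T,A,B)** := `μ(D)²·μ(U∩Aᶜ∩Bᶜ) ≤ μ(U)·μ(D∩Aᶜ)·μ(D∩Bᶜ)`.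
(R2 is certified exactly for all 2319 u-free four-point typed instances — prim-facecert gen 10, kit j144750/j145876/j145905/j146415 — and proved in Lean for
the PATH instance, `CovTrianglePath.r2_path`.)
-/

noncomputable section

namespace Summit.CriticalPhenomena.PercolationContinuityZ3.Theorems

namespace CovTrianglePath

open MeasureTheory Set Literature.Probability.Percolation
open Literature.Probability.LatticeModels (prodBernoulli prodBernoulli_harris)

variable {V : Type*} [Fintype V] (w : Sym2 V → unitInterval) (S T : Set V)

omit [Fintype V] in
/-- The separation event `{S ↮ T}` is decreasing. [folklore] -/
theorem isLowerSet_sepSet :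
    IsLowerSet {ω : BondConfig V | ∀ s ∈ S, ∀ t ∈ T, ¬ (openGraph ω).Reachable s t} :=
  fun _ _ hle hω s hs t ht hreach => hω s hs t ht (hreach.mono (openGraph_mono hle))

/-- **Typed covariance triangle from R2.**  For `μ = prodBernoulli w`, vertex sets `S, T` with `D = {S ↮ T}`, an increasing event `A` of type (+) and an
increasing event `B` of type (−) for `(C_S, C_T)`:  if `μ(D)²·μ(Dᶜ ∩ Aᶜ ∩ Bᶜ) ≤ μ(Dᶜ)·μ(D ∩ Aᶜ)·μ(D ∩ Bᶜ)` (R2) then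
`μ(D)²·(μ(A∩B) − μ(A)μ(B)) ≤ μ(D∩Bᶜ)·(μ(Dᶜ∩A) − μ(Dᶜ)μ(A)) + μ(D∩Aᶜ)·(μ(Dᶜ∩B) − μ(Dᶜ)μ(B))` (CT). [this work] -/
theorem covTriangle_typed_of_r2 {A B : Set (BondConfig V)} (hAup : IsUpperSet A) (hBup : IsUpperSet B)
    (hA : ∀ ⦃ω ω' : BondConfig V⦄, (⋃ s ∈ S, openEdgeCluster ω s) ⊆ (⋃ s ∈ S, openEdgeCluster ω' s) →
      (⋃ t ∈ T, openEdgeCluster ω' t) ⊆ (⋃ t ∈ T, openEdgeCluster ω t) → ω ∈ A → ω' ∈ A)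
    (hB : ∀ ⦃ω ω' : BondConfig V⦄, (⋃ s ∈ S, openEdgeCluster ω' s) ⊆ (⋃ s ∈ S, openEdgeCluster ω s) →
      (⋃ t ∈ T, openEdgeCluster ω t) ⊆ (⋃ t ∈ T, openEdgeCluster ω' t) → ω ∈ B → ω' ∈ B)
    (hR2 : (prodBernoulli w).real {ω : BondConfig V | ∀ s ∈ S, ∀ t ∈ T, ¬ (openGraph ω).Reachable s t} ^ 2 *
        (prodBernoulli w).real ({ω : BondConfig V | ∀ s ∈ S, ∀ t ∈ T, ¬ (openGraph ω).Reachable s t}ᶜ ∩ Aᶜ ∩ Bᶜ) ≤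
      (prodBernoulli w).real {ω : BondConfig V | ∀ s ∈ S, ∀ t ∈ T, ¬ (openGraph ω).Reachable s t}ᶜ *
        (prodBernoulli w).real ({ω : BondConfig V | ∀ s ∈ S, ∀ t ∈ T, ¬ (openGraph ω).Reachable s t} ∩ Aᶜ) *
        (prodBernoulli w).real ({ω : BondConfig V | ∀ s ∈ S, ∀ t ∈ T, ¬ (openGraph ω).Reachable s t} ∩ Bᶜ)) :
    (prodBernoulli w).real {ω : BondConfig V | ∀ s ∈ S, ∀ t ∈ T, ¬ (openGraph ω).Reachable s t} ^ 2 *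
        ((prodBernoulli w).real (A ∩ B) - (prodBernoulli w).real A * (prodBernoulli w).real B) ≤
      (prodBernoulli w).real ({ω : BondConfig V | ∀ s ∈ S, ∀ t ∈ T, ¬ (openGraph ω).Reachable s t} ∩ Bᶜ) *
          ((prodBernoulli w).real ({ω : BondConfig V | ∀ s ∈ S, ∀ t ∈ T, ¬ (openGraph ω).Reachable s t}ᶜ ∩ A) -
            (prodBernoulli w).real {ω : BondConfig V | ∀ s ∈ S, ∀ t ∈ T, ¬ (openGraph ω).Reachable s t}ᶜ * (prodBernoulli w).real A) +
        (prodBernoulli w).real ({ω : BondConfig V | ∀ s ∈ S, ∀ t ∈ T, ¬ (openGraph ω).Reachable s t} ∩ Aᶜ) *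
          ((prodBernoulli w).real ({ω : BondConfig V | ∀ s ∈ S, ∀ t ∈ T, ¬ (openGraph ω).Reachable s t}ᶜ ∩ B) -
            (prodBernoulli w).real {ω : BondConfig V | ∀ s ∈ S, ∀ t ∈ T, ¬ (openGraph ω).Reachable s t}ᶜ * (prodBernoulli w).real B) := by
  set D : Set (BondConfig V) := {ω : BondConfig V | ∀ s ∈ S, ∀ t ∈ T, ¬ (openGraph ω).Reachable s t} with hD
  have hDup : IsUpperSet Dᶜ := (isLowerSet_sepSet (V := V) S T).compl
  -- two-set row (BHK): μ(D ∩ (A ∩ B)) μ(D) ≤ μ(D ∩ A) μ(D ∩ B)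
  have hts := setTwoClusterExchange w S T (A₁ := A) (A₂ := Set.univ) (B₁ := B) (B₂ := Set.univ)
    hA (fun _ _ _ _ _ => Set.mem_univ _) hB (fun _ _ _ _ _ => Set.mem_univ _)
  rw [← hD] at hts
  simp only [Set.inter_univ] at hts
  have hCA : (prodBernoulli w).real Dᶜᶜ * (prodBernoulli w).real (Dᶜᶜ ∩ A ∩ B) ≤
      (prodBernoulli w).real (Dᶜᶜ ∩ A) * (prodBernoulli w).real (Dᶜᶜ ∩ B) := by
    rw [compl_compl, Set.inter_assoc]; linarith [hts]
  have hUA : (prodBernoulli w).real Dᶜ * (prodBernoulli w).real A ≤ (prodBernoulli w).real (Dᶜ ∩ A) :=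
    prodBernoulli_harris w hDup hAup MeasurableSet.of_discrete MeasurableSet.of_discrete
  have hUB : (prodBernoulli w).real Dᶜ * (prodBernoulli w).real B ≤ (prodBernoulli w).real (Dᶜ ∩ B) :=
    prodBernoulli_harris w hDup hBup MeasurableSet.of_discrete MeasurableSet.of_discrete
  have hR2' : (prodBernoulli w).real Dᶜᶜ ^ 2 * (prodBernoulli w).real (Dᶜ ∩ Aᶜ ∩ Bᶜ) ≤
      (prodBernoulli w).real Dᶜ * (prodBernoulli w).real (Dᶜᶜ ∩ Aᶜ) * (prodBernoulli w).real (Dᶜᶜ ∩ Bᶜ) := by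
    rw [compl_compl]; exact hR2
  have key := covTriangle_of_r2 (prodBernoulli w) (U := Dᶜ) (MeasurableSet.of_discrete) (MeasurableSet.of_discrete)
    (MeasurableSet.of_discrete) hCA hUA hUB hR2'
  rw [compl_compl] at key
  exact key

end CovTrianglePath

end Summit.CriticalPhenomena.PercolationContinuityZ3.Theorems
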